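import Mathlib
import HarnessLib

/-!
# Modular data: fusion rules, unitary multiplicity-free premodular (6j / braiding) data, modular data

Topic `Literature/RepresentationTheory/ModularTensorCategories` (definition item `defn-ModularDatum`,
for route `QuantumFields/ModularSelfDualFold`, items `ModularSelfDuality`, `NoSelfDualMasslessBand`:
the level-`k` Walker–Wang / Verlinde-field Hamiltonian is built from the F-, R- and S-symbols of a
modular datum; first instance `SU(2)_k`).

Mathlib has monoidal / braided categories but no fusion categories, no 6j-symbols, no S-matrix, no
Verlinde formula (searched: `Verlinde`, `FusionCat`, `sixJ`, `pentagon` outside `CategoryTheory`).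
Following the item ("no category theory needed; axioms as FIELDS") we formalise the SKELETAL
description of a unitary, multiplicity-free ribbon fusion category by numbers, exactly as in the
anyon literature (Kitaev 2006, App. E; Rowell–Stong–Wang 2009, §§2, 5; Bonderson 2007, ch. 2):

* `FusionRules L` — a commutative fusion ring on the finite label set `L` (Gannon, Def. 6.1.3):
  unit label, involution `dual`, multiplicities `N a b c = N_{ab}^c ∈ ℕ` with unit, commutativity,
  associativity, duality (`N_{ab}^1 = δ_{b,ā}`) and conjugation symmetry (`N_{ā b̄}^{c̄} = N_{ab}^c`).
* `PreModularDatum L` — multiplicity-free (`N ≤ 1`) fusion rules together with quantum dimensions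
  `d`, unitary F-symbols `F a b c d e f = [F^{abc}_d]_{ef}` (pentagon, triangle/unit normalisation,
  duality axiom `|[F^{aāa}_a]_{11}| = d_a⁻¹`), unitary R-symbols `R a b c = R^{ab}_c` (both hexagons),
  twists `θ_a = d_a⁻¹ Σ_c d_c R^{aa}_c` with `R^{ba}_c R^{ab}_c = θ_c/(θ_a θ_b)`, and the topological
  S-matrix `S_{ab} = D⁻¹ Σ_c N_{a b̄}^c (θ_c/(θ_a θ_b)) d_c` (Kitaev (E.4)), `D = √(Σ d_a²)`.
  Every field after the data is a PRINTED IDENTITY of the skeletal calculus of a unitary braided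
  fusion category in a unitary gauge with trivial unit moves (locators on each field); the redundant
  ones (`d`, `θ`, `S` are determined by `N`, `F`, `R`) are carried as data + defining equation so that
  instances can expose closed forms (e.g. `S_{ab} = √(2/(k+2)) sin(π(a+1)(b+1)/(k+2))` for `SU(2)_k`).
* `PreModularDatum.IsModular` — `S` unitary (Kitaev E.5: braiding nondegeneracy = modularity).
* `ModularDatum L` — a premodular datum whose `S` is unitary, carrying as further fields the two
  standard consequences the route uses: `S² = C` (charge conjugation) and the Verlinde formula
  `N_{ab}^c = Σ_x S_{ax} S_{bx} conj(S_{cx}) / S_{0x}` (RSW Def. 2.1; Gannon (6.1.1b); Kitaev (E.4)).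
  These are theorems about modular categories (Bakalov–Kirillov Thm. 3.1.7, 3.1.13) which we do not
  re-derive from the skeletal axioms here; an instance proves them directly (finite identities).
* API: `dual_unit`, `N_unit_right`, Frobenius reciprocity `N_eq_N_dual_dual`, `d_unit`, `twist_unit`,
  `totalDim`, `S_unit_left/right = d/D`, symmetry of `S`, `T`, the predicates `HasSL2ZRelation`
  (`(ST)³ = (p₊/D) S²`, RSW Def. 2.1(i)) and `IsModular`.

Conventions (fixed once and for all; Kitaev App. E): `[F^{abc}_d]_{ef}` are the coefficients
of the F-move expanding the left-nested fusion tree in the right-nested ones,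
`|((ab)_e c)_d⟩ = Σ_f [F^{abc}_d]_{ef} |(a(bc)_f)_d⟩`; `R^{ab}_c` is the braiding eigenvalue on the
channel `a ⊗ b → c` (`c_{a,b} |(ab)_c⟩ = R^{ab}_c |(ba)_c⟩`); all symbols are EXTENDED BY ZERO
outside admissible labellings, so pentagon and hexagon are stated for all indices (both sides
vanish on inadmissible ones). Pentagon:
`[F^{fcd}_e]_{gl} [F^{abl}_e]_{fk} = Σ_h [F^{abc}_g]_{fh} [F^{ahd}_e]_{gk} [F^{bcd}_k]_{hl}`;
hexagons: `R^{ca}_e [F^{acb}_d]_{eg} R^{cb}_g = Σ_f [F^{cab}_d]_{ef} R^{cf}_d [F^{abc}_d]_{fg}` and the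
same with every `R^{xy}_z` replaced by `(R^{yx}_z)⁻¹`.

Deliberately NOT here: fusion multiplicities `> 1` (F, R would be block matrices; not needed for
`SU(2)_k`, pointed or Ising data — hence `Rep(G)` for non-abelian `G` is not an instance);
tetrahedral symmetry of 6j-symbols (gauge-dependent, fails for some pointed categories; state it
per instance); the central charge / `(ST)³` relation as an axiom (it is the predicate
`HasSL2ZRelation`); the categorical reconstruction (Turaev; Yamagami) of a ribbon category from the
datum. Instances (`SU(2)_k`, semion, pointed `ℤ_N`) live in sibling files.
-/

noncomputable section

open scoped ComplexConjugate Matrix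

namespace Literature.RepresentationTheory.ModularTensorCategories

universe u

variable {L : Type u} [Fintype L] [DecidableEq L]

/-- **Commutative fusion rules** on a finite label set `L` (the structure constants of a
commutative fusion ring with its preferred basis): a unit label, an involution `dual` (charge
conjugation) and multiplicities `N a b c = N_{ab}^c` such that `N_{1b}^c = δ_{bc}`,
`N_{ab}^c = N_{ba}^c`, `Σ_e N_{ab}^e N_{ec}^d = Σ_f N_{bc}^f N_{af}^d` (associativity),
`N_{ab}^1 = δ_{b,ā}` and `N_{ā b̄}^{c̄} = N_{ab}^c`.
[cite: Gannon2023, Def. 6.1.3 (fusion ring, F1–F3) and §6.1.1] -/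
structure FusionRules (L : Type u) [Fintype L] [DecidableEq L] where
  /-- The unit (vacuum) label, written `0` or `1` in the literature. -/
  unit : L
  /-- Charge conjugation `a ↦ ā`. -/
  dual : L → L
  /-- Fusion multiplicities `N a b c = N_{ab}^c = dim Hom(a ⊗ b, c)`. -/
  N : L → L → L → ℕ
  /-- `ā̄ = a`. -/
  dual_dual : ∀ a, dual (dual a) = a
  /-- The unit is a unit: `N_{1b}^c = δ_{bc}`. -/
  N_unit_left : ∀ b c, N unit b c = if b = c then 1 else 0
  /-- Commutativity `N_{ab}^c = N_{ba}^c` (automatic in the braided case). -/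
  N_comm : ∀ a b c, N a b c = N b a c
  /-- Associativity `(a ⊗ b) ⊗ c ≅ a ⊗ (b ⊗ c)` on multiplicities. -/
  N_assoc : ∀ a b c d, ∑ e, N a b e * N e c d = ∑ f, N b c f * N a f d
  /-- Duality: the unit occurs in `a ⊗ b` exactly when `b = ā`, and then once. -/
  N_dual : ∀ a b, N a b unit = if b = dual a then 1 else 0
  /-- Conjugation is a fusion-ring automorphism: `N_{ā b̄}^{c̄} = N_{ab}^c`. -/
  N_conj : ∀ a b c, N (dual a) (dual b) (dual c) = N a b c

namespace FusionRules

variable (C : FusionRules L)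

/-- The fusion matrix `(N_a)_{bc} = N_{ab}^c`. [cite: Gannon2023, §6.1.1 (fusion matrices)] -/
def fusionMatrix (a : L) : Matrix L L ℕ := Matrix.of fun b c => C.N a b c

/-- The charge-conjugation matrix `C_{ab} = δ_{a, b̄}` (complex entries).
[cite: RowellStongWang2007, Def. 2.1 (charge conjugation matrix)] -/
def chargeConj : Matrix L L ℂ := Matrix.of fun a b => if a = C.dual b then 1 else 0

/-- `N_{b1}^c = δ_{bc}`. [folklore] -/
theorem N_unit_right (b c : L) : C.N b C.unit c = if b = c then 1 else 0 := by
  rw [C.N_comm]; exact C.N_unit_left b c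

/-- The unit is self-dual, `1̄ = 1` (from `N_{11}^1 = 1` and the duality axiom). [folklore] -/
theorem dual_unit : C.dual C.unit = C.unit := by
  have h1 : C.N C.unit C.unit C.unit = 1 := by simp [C.N_unit_left]
  have h2 := C.N_dual C.unit C.unit
  rw [h1] at h2
  by_contra h
  rw [if_neg (Ne.symm h)] at h2
  exact one_ne_zero h2

/-- `dual` is injective. [folklore] -/
theorem dual_injective : Function.Injective C.dual :=
  Function.LeftInverse.injective C.dual_dual

/-- `ā = b̄ ↔ a = b`. [folklore] -/
@[simp] theorem dual_inj {a b : L} : C.dual a = C.dual b ↔ a = b := C.dual_injective.eq_iff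

/-- Charge conjugation as a permutation of the labels. [folklore] -/
def dualEquiv : L ≃ L := ⟨C.dual, C.dual, C.dual_dual, C.dual_dual⟩

/-- `dualEquiv` is `dual`. [folklore] -/
@[simp] theorem dualEquiv_apply (a : L) : C.dualEquiv a = C.dual a := rfl

/-- Frobenius reciprocity `N_{ab}^c = N_{b c̄}^{ā}`, derived from associativity and duality.
[cite: RowellStongWang2007, §2 (symmetries of n_{ij}^k after Def. 2.1)] -/
theorem N_eq_N_dual_dual (a b c : L) : C.N a b c = C.N b (C.dual c) (C.dual a) := by
  have h := C.N_assoc a b (C.dual c) C.unit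
  have l1 : ∀ e, C.N e (C.dual c) C.unit = if c = e then 1 else 0 := fun e => by
    rw [C.N_dual]; simp
  have r1 : ∀ f, C.N a f C.unit = if f = C.dual a then 1 else 0 := fun f => C.N_dual a f
  simp only [l1, r1, mul_ite, mul_one, mul_zero, Finset.sum_ite_eq, Finset.sum_ite_eq',
    Finset.mem_univ, if_true] at h
  exact h

end FusionRules

/-- **Unitary multiplicity-free premodular datum** on the label set `L`: commutative
multiplicity-free fusion rules with quantum dimensions `d`, unitary F-symbols
`F a b c d e f = [F^{abc}_d]_{ef}` (pentagon; trivial unit moves; duality axiom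
`|[F^{aāa}_a]_{11}| = 1/d_a`), unitary R-symbols `R a b c = R^{ab}_c` (the two hexagon equations,
trivial braiding with the unit), twists `θ_a = d_a⁻¹ Σ_c d_c R^{aa}_c` (`|θ_a| = 1`, `θ_ā = θ_a`,
`R^{ba}_c R^{ab}_c = θ_c/(θ_a θ_b)`) and the topological S-matrix
`S_{ab} = D⁻¹ Σ_c N_{a b̄}^c (θ_c/(θ_a θ_b)) d_c`, `D = √(Σ_a d_a²)` — the skeletal data of a unitary
ribbon fusion category with simple objects `L` and one-dimensional multiplicity spaces, all symbols
extended by zero outside admissible labellings (conventions in the module docstring).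
[cite: Kitaev2006, App. E.1.2 (pentagon, triangle), E.2 (duality axiom, d_ā = d_a, d_a d_b = Σ N d_c), E.3 (hexagons, θ_a, R^{ba}R^{ab} = θ_c/θ_aθ_b), E.4 (s_ab)]
[cite: RowellStongWang2007, §5.1–5.2 (F-matrices, unit F = identity, braiding eigenvalues, twists)] -/
structure PreModularDatum (L : Type u) [Fintype L] [DecidableEq L] extends FusionRules L where
  /-- Multiplicity-freeness: every `Hom(a ⊗ b, c)` has dimension `≤ 1`. -/
  N_le_one : ∀ a b c, N a b c ≤ 1
  /-- Quantum dimensions `d_a`. -/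
  d : L → ℝ
  /-- `d_a > 0` (unitarity). -/
  d_pos : ∀ a, 0 < d a
  /-- `d_ā = d_a`. -/
  d_dual : ∀ a, d (dual a) = d a
  /-- `d` is a character of the fusion ring: `d_a d_b = Σ_c N_{ab}^c d_c`. -/
  d_fusion : ∀ a b, d a * d b = ∑ c, N a b c * d c
  /-- F-symbols `F a b c d e f = [F^{abc}_d]_{ef}`, from `((ab)_e c)_d` to `(a(bc)_f)_d`. -/
  F : L → L → L → L → L → L → ℂ
  /-- `F` vanishes outside admissible labellings. -/
  F_support : ∀ a b c d e f, N a b e * N e c d * N b c f * N a f d = 0 → F a b c d e f = 0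
  /-- Trivial unit moves (triangle equations / gauge): if one of `a, b, c` is the unit then
  `F^{abc}_d` is the identity on its (one) admissible entry. -/
  F_unit : ∀ a b c d e f, (a = unit ∨ b = unit ∨ c = unit) →
    N a b e * N e c d * N b c f * N a f d ≠ 0 → F a b c d e f = 1
  /-- Unitarity of each `F^{abc}_d` (rows): `Σ_f [F]_{ef} conj [F]_{e'f} = δ_{ee'}` on admissible `e`. -/
  F_unitary : ∀ a b c d e e', ∑ f, F a b c d e f * conj (F a b c d e' f) =
    if e = e' ∧ N a b e * N e c d ≠ 0 then 1 else 0
  /-- Unitarity of each `F^{abc}_d` (columns). -/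
  F_unitary' : ∀ a b c d f f', ∑ e, conj (F a b c d e f) * F a b c d e f' =
    if f = f' ∧ N b c f * N a f d ≠ 0 then 1 else 0
  /-- Duality axiom in the unitary gauge: `|[F^{aāa}_a]_{11}| = 1/d_a`. -/
  norm_F_dual : ∀ a, ‖F a (dual a) a a unit unit‖ = (d a)⁻¹
  /-- Pentagon equation:
  `[F^{fcd}_e]_{gl} [F^{abl}_e]_{fk} = Σ_h [F^{abc}_g]_{fh} [F^{ahd}_e]_{gk} [F^{bcd}_k]_{hl}`. -/
  pentagon : ∀ a b c d e f g k l,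
    F f c d e g l * F a b l e f k = ∑ h, F a b c g f h * F a h d e g k * F b c d k h l
  /-- R-symbols (braiding eigenvalues) `R a b c = R^{ab}_c` on the channel `a ⊗ b → c`. -/
  R : L → L → L → ℂ
  /-- `R` vanishes outside admissible channels. -/
  R_support : ∀ a b c, N a b c = 0 → R a b c = 0
  /-- Unitarity of the braiding: `|R^{ab}_c| = 1` on admissible channels. -/
  norm_R : ∀ a b c, N a b c ≠ 0 → ‖R a b c‖ = 1
  /-- Braiding with the unit is trivial. -/
  R_unit_left : ∀ a, R unit a a = 1
  /-- Braiding with the unit is trivial. -/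
  R_unit_right : ∀ a, R a unit a = 1
  /-- First hexagon: `R^{ca}_e [F^{acb}_d]_{eg} R^{cb}_g = Σ_f [F^{cab}_d]_{ef} R^{cf}_d [F^{abc}_d]_{fg}`. -/
  hexagon : ∀ a b c d e g,
    R c a e * F a c b d e g * R c b g = ∑ f, F c a b d e f * R c f d * F a b c d f g
  /-- Second hexagon (inverse braiding):
  `(R^{ac}_e)⁻¹ [F^{acb}_d]_{eg} (R^{bc}_g)⁻¹ = Σ_f [F^{cab}_d]_{ef} (R^{fc}_d)⁻¹ [F^{abc}_d]_{fg}`. -/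
  hexagon_inv : ∀ a b c d e g,
    (R a c e)⁻¹ * F a c b d e g * (R b c g)⁻¹ = ∑ f, F c a b d e f * (R f c d)⁻¹ * F a b c d f g
  /-- Twists (topological spins) `θ_a`. -/
  twist : L → ℂ
  /-- `θ_a = d_a⁻¹ Σ_c d_c R^{aa}_c`. -/
  twist_eq : ∀ a, twist a = (∑ c, (d c : ℂ) * R a a c) / d a
  /-- `|θ_a| = 1`. -/
  norm_twist : ∀ a, ‖twist a‖ = 1
  /-- `θ_ā = θ_a`. -/
  twist_dual : ∀ a, twist (dual a) = twist a
  /-- Ribbon/monodromy identity `R^{ab}_c R^{ba}_c = θ_c / (θ_a θ_b)` on admissible channels. -/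
  ribbon : ∀ a b c, N a b c ≠ 0 → R a b c * R b a c = twist c / (twist a * twist b)
  /-- The topological S-matrix. -/
  S : Matrix L L ℂ
  /-- `S_{ab} = D⁻¹ Σ_c N_{a b̄}^c (θ_c/(θ_a θ_b)) d_c` with `D = √(Σ_x d_x²)`. -/
  S_eq : ∀ a b, S a b =
    (∑ c, (N a (dual b) c : ℂ) * (twist c / (twist a * twist b)) * d c) / (Real.sqrt (∑ x, d x ^ 2) : ℝ)

namespace PreModularDatum

variable (C : PreModularDatum L)

/-- The global dimension squared `D² = Σ_a d_a²`. [cite: Kitaev2006, App. E.4 (𝒟 = √Σ d_a²)] -/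
def totalDimSq : ℝ := ∑ a, C.d a ^ 2

/-- The total quantum dimension `D = √(Σ_a d_a²)`. [cite: Kitaev2006, App. E.4 (𝒟 = √Σ d_a²)] -/
def totalDim : ℝ := Real.sqrt C.totalDimSq

/-- The T-matrix `T = diag(θ_a)`. [cite: RowellStongWang2007, Def. 2.1 (modular symbol, T)] -/
def T : Matrix L L ℂ := Matrix.diagonal C.twist

/-- The Gauss sums `p_± = Σ_a θ_a^{±1} d_a²` (here `p₊`). [cite: RowellStongWang2007, Def. 2.1 (D_±)] -/
def gaussSumPlus : ℂ := ∑ a, C.twist a * (C.d a : ℂ) ^ 2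

/-- **Modularity** of a premodular datum: the S-matrix is unitary (equivalently, the braiding is
nondegenerate). [cite: Kitaev2006, App. E.5 (braiding nondegeneracy = modularity)] -/
def IsModular (C : PreModularDatum L) : Prop := C.S * C.Sᴴ = 1

/-- The `SL₂(ℤ)` relation `(ST)³ = (p₊/D) S²` (with `s₀₀ = 1/D`), a property of every modular
category, recorded as a predicate (not an axiom of `ModularDatum`).
[cite: RowellStongWang2007, Def. 2.1 (i)] -/
def HasSL2ZRelation (C : PreModularDatum L) : Prop :=
  (C.S * C.T) ^ 3 = (C.gaussSumPlus / (C.totalDim : ℂ)) • (C.S * C.S)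

/-- `d_a ≠ 0`. [folklore] -/
theorem d_ne_zero (a : L) : C.d a ≠ 0 := (C.d_pos a).ne'

/-- `(d_a : ℂ) ≠ 0`. [folklore] -/
theorem d_cast_ne_zero (a : L) : (C.d a : ℂ) ≠ 0 := Complex.ofReal_ne_zero.mpr (C.d_ne_zero a)

/-- `θ_a ≠ 0`. [folklore] -/
theorem twist_ne_zero (a : L) : C.twist a ≠ 0 := fun h => by simpa [h] using C.norm_twist a

/-- `d_1 = 1` (from `d_1 d_b = d_b`). [cite: Kitaev2006, App. E.2 (d_a = 1 for abelian particles)] -/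
theorem d_unit : C.d C.unit = 1 := by
  have h := C.d_fusion C.unit C.unit
  simp only [C.N_unit_left, Nat.cast_ite, Nat.cast_one, Nat.cast_zero, ite_mul, one_mul,
    zero_mul, Finset.sum_ite_eq, Finset.mem_univ, if_true] at h
  exact (mul_eq_right₀ (C.d_ne_zero C.unit)).mp h

/-- `θ_1 = 1`. [cite: RowellStongWang2007, Def. 2.1 (θ₀ = 1)] -/
theorem twist_unit : C.twist C.unit = 1 := by
  rw [C.twist_eq, Finset.sum_eq_single C.unit, C.R_unit_left, mul_one,
    div_self (C.d_cast_ne_zero _)]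
  · intro c _ hc
    rw [C.R_support, mul_zero]
    rw [C.N_unit_left, if_neg (Ne.symm hc)]
  · exact fun h => (h (Finset.mem_univ _)).elim

/-- `0 < D²`. [folklore] -/
theorem totalDimSq_pos : 0 < C.totalDimSq :=
  Finset.sum_pos (fun a _ => pow_pos (C.d_pos a) 2) ⟨C.unit, Finset.mem_univ _⟩

/-- `1 ≤ D²` (the unit contributes `d_1² = 1`). [folklore] -/
theorem one_le_totalDimSq : 1 ≤ C.totalDimSq := by
  have h : C.d C.unit ^ 2 ≤ C.totalDimSq :=
    Finset.single_le_sum (f := fun a => C.d a ^ 2) (fun a _ => sq_nonneg (C.d a))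
      (Finset.mem_univ C.unit)
  simpa [C.d_unit] using h

/-- `0 < D`. [folklore] -/
theorem totalDim_pos : 0 < C.totalDim := Real.sqrt_pos.mpr C.totalDimSq_pos

/-- `D² = Σ d_a²`. [folklore] -/
theorem totalDim_sq : C.totalDim ^ 2 = C.totalDimSq := Real.sq_sqrt C.totalDimSq_pos.le

/-- `(D : ℂ) ≠ 0`. [folklore] -/
theorem totalDim_cast_ne_zero : (C.totalDim : ℂ) ≠ 0 :=
  Complex.ofReal_ne_zero.mpr C.totalDim_pos.ne'

/-- The defining formula of `S` with `D` named. [cite: Kitaev2006, App. E.4 (s_ab)] -/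
theorem S_apply (a b : L) : C.S a b =
    (∑ c, (C.N a (C.dual b) c : ℂ) * (C.twist c / (C.twist a * C.twist b)) * C.d c) / (C.totalDim : ℂ) :=
  C.S_eq a b

/-- `S_{1a} = d_a / D`. [cite: Kitaev2006, App. E.4 (s_{1x} = d_x/𝒟)] -/
theorem S_unit_left (a : L) : C.S C.unit a = (C.d a : ℂ) / (C.totalDim : ℂ) := by
  rw [C.S_apply]
  congr 1
  rw [Finset.sum_eq_single (C.dual a)]
  · rw [C.N_unit_left, if_pos rfl, C.twist_dual, C.d_dual, C.twist_unit, one_mul, Nat.cast_one,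
      one_mul, div_self (C.twist_ne_zero a), one_mul]
  · intro c _ hc
    rw [C.N_unit_left, if_neg (Ne.symm hc), Nat.cast_zero, zero_mul, zero_mul]
  · exact fun h => (h (Finset.mem_univ _)).elim

/-- `S_{a1} = d_a / D`. [cite: Kitaev2006, App. E.4 (s_ab = s_ba, s_{1x} = d_x/𝒟)] -/
theorem S_unit_right (a : L) : C.S a C.unit = (C.d a : ℂ) / (C.totalDim : ℂ) := by
  rw [C.S_apply]
  congr 1
  rw [C.dual_unit, Finset.sum_eq_single a]
  · rw [C.N_unit_right, if_pos rfl, C.twist_unit, mul_one, Nat.cast_one, one_mul,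
      div_self (C.twist_ne_zero a), one_mul]
  · intro c _ hc
    rw [C.N_unit_right, if_neg (Ne.symm hc), Nat.cast_zero, zero_mul, zero_mul]
  · exact fun h => (h (Finset.mem_univ _)).elim

/-- `S_{11} = 1/D`. [cite: RowellStongWang2007, §5.3 ((0,0) entry of S is 1/D)] -/
theorem S_unit_unit : C.S C.unit C.unit = 1 / (C.totalDim : ℂ) := by
  rw [C.S_unit_left, C.d_unit, Complex.ofReal_one]

/-- Symmetry of the S-matrix, `S_{ab} = S_{ba}`. [cite: Kitaev2006, App. E.4 (s_ab = s_ba)] -/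
theorem S_symm (a b : L) : C.S a b = C.S b a := by
  rw [C.S_apply, C.S_apply]
  congr 1
  have key : ∀ c, C.N b (C.dual a) (C.dual c) = C.N a (C.dual b) c := fun c => by
    have h := C.N_conj b (C.dual a) (C.dual c)
    rw [C.dual_dual, C.dual_dual] at h
    rw [← h, C.N_comm]
  refine Fintype.sum_equiv C.dualEquiv _ _ (fun c => ?_)
  rw [C.dualEquiv_apply, key c, C.twist_dual, C.d_dual, mul_comm (C.twist a)]

/-- The S-matrix is a symmetric matrix. [cite: Kitaev2006, App. E.4 (s_ab = s_ba)] -/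
theorem S_isSymm : C.S.IsSymm := Matrix.IsSymm.ext fun a b => C.S_symm b a

end PreModularDatum

/-- **Unitary multiplicity-free modular datum**: a premodular datum whose S-matrix is unitary
(modularity), together with — as fields, since they are consequences we do not re-derive from the
skeletal axioms — charge conjugation `S² = C` and the Verlinde formula
`N_{ab}^c = Σ_x S_{ax} S_{bx} conj(S_{cx}) / S_{1x}`. This is the input of the Reshetikhin–Turaev /
Walker–Wang constructions; `(N; S, T)` is then modular data in the sense of Gannon / a modular
symbol in the sense of Rowell–Stong–Wang (the `SL₂(ℤ)` relation is the predicate `HasSL2ZRelation`).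
[cite: RowellStongWang2007, Def. 2.1 (modular symbol: S unitary symmetric, S² = C, Verlinde)]
[cite: Gannon2023, Def. 6.1.6 (modular data MD1, MD2, MD4) and eq. (6.1.1b) (Verlinde)]
[cite: Kitaev2006, App. E.4 (Verlinde formula), E.5 (unitarity of S = modularity)] -/
structure ModularDatum (L : Type u) [Fintype L] [DecidableEq L] extends PreModularDatum L where
  /-- Modularity: `S` is unitary. -/
  S_unitary : S * Sᴴ = 1
  /-- `S² = C`, the charge-conjugation matrix `C_{ab} = δ_{a b̄}`. -/
  S_mul_S : S * S = Matrix.of fun a b => if a = dual b then (1 : ℂ) else 0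
  /-- Verlinde formula `N_{ab}^c = Σ_x S_{ax} S_{bx} conj(S_{cx}) / S_{1x}`. -/
  verlinde : ∀ a b c, (N a b c : ℂ) = ∑ x, S a x * S b x * conj (S c x) / S unit x

namespace ModularDatum

variable (C : ModularDatum L)

/-- A modular datum is modular. [cite: Kitaev2006, App. E.5] -/
theorem isModular : C.IsModular := C.S_unitary

/-- `S² = C` with the charge-conjugation matrix named. [cite: RowellStongWang2007, Def. 2.1 (ii)] -/
theorem S_mul_S_eq_chargeConj : C.S * C.S = C.chargeConj := C.S_mul_S

/-- `S` is invertible with inverse `Sᴴ`. [folklore] -/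
theorem conjTranspose_mul_S : C.Sᴴ * C.S = 1 :=
  mul_eq_one_comm.mp C.S_unitary

/-- `S⁴ = 1` (since `C² = 1`). [cite: RowellStongWang2007, Def. 2.1 (C² = I_n)] -/
theorem chargeConj_mul_chargeConj : C.chargeConj * C.chargeConj = (1 : Matrix L L ℂ) := by
  ext a b
  rw [Matrix.mul_apply, Finset.sum_eq_single (C.dual a)]
  · simp [FusionRules.chargeConj, C.dual_dual, FusionRules.dual_inj, Matrix.one_apply]
  · intro x _ hx
    simp only [FusionRules.chargeConj, Matrix.of_apply]
    rw [if_neg, zero_mul]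
    intro hax
    apply hx
    rw [hax, C.dual_dual]
  · exact fun h => (h (Finset.mem_univ _)).elim

/-- `S_{1a} = d_a/D` is a positive real (Gannon's MD2). [cite: Gannon2023, Def. 6.1.6 (MD2)] -/
theorem S_unit_left_pos (a : L) : 0 < (C.S C.unit a).re ∧ (C.S C.unit a).im = 0 := by
  rw [C.S_unit_left, ← Complex.ofReal_div]
  exact ⟨by simpa using div_pos (C.d_pos a) C.totalDim_pos, Complex.ofReal_im _⟩

end ModularDatum

end Literature.RepresentationTheory.ModularTensorCategories
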